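import Literature.NumberTheory.Irrationality.Zudilin2003.CatalanSeries
import Literature.NumberTheory.Irrationality.Zudilin2003.Theorem1
import Summits.KontsevichZagierPeriods.Zeta5Search.Zudilin2003ExactDecay
import Summits.KontsevichZagierPeriods.Zeta5Search.CatalanFamilyCertificates
import Summits.KontsevichZagierPeriods.Zeta5Search.NearMissNoCertificate
import HarnessLib

/-!
# ζ(5) search — Catalan arm: Zudilin's 2003 rates are now UNCONDITIONAL (cell `pub-zeta5`, TYPER)

HONEST FRAMING: systematic search; no irrationality claim unless certified.

Row G of `NEAR-MISSES.md` (Zudilin's second-order recursion for Catalan's constant). The typer-g4 files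
`Zudilin2003ExactRates` / `Zudilin2003ExactDecay` proved growth, non-vanishing and decay for THE LIMIT `L`
of `vₙ/uₙ` and packaged `rates_of_tendsto : (vₙ/uₙ → G) → Zudilin2003.rates`; the cell's certificates
file `CatalanFamilyCertificates` states its scaled-forms rate and margin under the HYPOTHESIS
`(h : rates)`. The lit seat has now PROVED the identification `vₙ/uₙ → G`
(`Literature.…Zudilin2003.tendsto_v_div_u`, Zudilin 2003 Sect. 2, Lemmas 1–5). Hence, with no
hypothesis left:

* `tendsto_vR_div_uR` — `vₙ/uₙ → G` in the real-valued normalisation of the Summit files;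
* `rates_holds : Zudilin2003.rates` — **the cited rates are a THEOREM**: `uₙ^{1/n} → ((1+√5)/2)⁵`,
  `uₙG - vₙ ≠ 0` for every `n`, `|uₙG - vₙ|^{1/n} → ((√5-1)/2)⁵`;
* `form_ne_zero`, `tendsto_root_abs_form`, `tendsto_log_abs_form_div` (`log|uₙG - vₙ|/n → -log((1+√5)/2)⁵
  = -2.40605912…`), `tendsto_log_abs_sub_catalan_div` (`log|G - vₙ/uₙ|/n → -2 log((1+√5)/2)⁵`);
* `scaled_forms_rate`, `margin_lt` — the row-G statements of `CatalanFamilyCertificates` UNCONDITIONALLY: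
  `log(2^{4n}D_{2n-1}²|uₙG - vₙ|)/n → r ∈ (4.366, 4.367)` and `c - δ < -4.366` for any admissible
  exponents (the family is no certificate: margin `< 0`, as recorded in `NEAR-MISSES.md`).

Everything is PROVED (0 sorry); no cited input remains on the Catalan arm except the integrality
clause of Theorem 1 (closed separately in `Literature/…/Zudilin2003/Theorem1.lean`).
-/

noncomputable section

open Filter Topology
open Literature.NumberTheory.Irrationality.Zudilin2003
open Literature.NumberTheory.Transcendental

namespace Summit.KontsevichZagierPeriods.Zeta5Search

namespace Zudilin2003Growth

/-- **`vₙ/uₙ → G`** (lit: `Zudilin2003.tendsto_v_div_u`), in the `uR, vR` normalisation. -/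
theorem tendsto_vR_div_uR : Tendsto (fun n : ℕ => vR n / uR n) atTop (𝓝 catalanConstant) := by
  refine tendsto_v_div_u.congr fun n => ?_
  unfold vR uR
  push_cast
  rfl

/-- **`Zudilin2003.rates` holds** (the named fact of `CatalanRecursion.lean`, now a theorem). -/
theorem rates_holds : rates := rates_of_tendsto tendsto_vR_div_uR

/-- **`uₙG - vₙ ≠ 0` for every `n`.** -/
theorem form_ne_zero (n : ℕ) : form n ≠ 0 := rates_holds.2.1 n

/-- **`|uₙG - vₙ|^{1/n} → ((√5-1)/2)⁵ = e^{-2.40605912…}`.** -/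
theorem tendsto_root_abs_form :
    Tendsto (fun n : ℕ => |form n| ^ (1 / (n : ℝ))) atTop (𝓝 (((Real.sqrt 5 - 1) / 2) ^ 5)) :=
  rates_holds.2.2

/-- **`log|uₙG - vₙ|/n → -log ((1+√5)/2)⁵`.** -/
theorem tendsto_log_abs_form_div :
    Tendsto (fun n : ℕ => Real.log |form n| / n) atTop (𝓝 (-Real.log (((1 + Real.sqrt 5) / 2) ^ 5))) := by
  refine (tendsto_log_abs_form_div_of_tendsto tendsto_vR_div_uR).congr fun n => ?_
  unfold form uR vR
  rfl

/-- **`log|G - vₙ/uₙ|/n → -2 log ((1+√5)/2)⁵`** (the approximations `vₙ/uₙ` of the source's table). -/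
theorem tendsto_log_abs_sub_catalan_div :
    Tendsto (fun n : ℕ => Real.log |catalanConstant - vR n / uR n| / n) atTop
      (𝓝 (-2 * Real.log (((1 + Real.sqrt 5) / 2) ^ 5))) :=
  tendsto_log_abs_sub_div_of_tendsto tendsto_vR_div_uR

end Zudilin2003Growth

namespace CatalanFamily

/-- **Row G scaled-forms rate, UNCONDITIONAL**: `log(2^{4n} D_{2n-1}² |uₙG - vₙ|)/n → r`, `4.366 < r < 4.367`. -/
theorem scaled_forms_rate_holds :
    ∃ r : ℝ, (4366 / 1000 : ℝ) < r ∧ r < 4367 / 1000 ∧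
      Tendsto (fun n : ℕ =>
        Real.log ((2 : ℝ) ^ (4 * n) * (Nat.lcmUpto (2 * n - 1) : ℝ) ^ 2 * |form n|) / n) atTop (𝓝 r) :=
  scaled_forms_rate Zudilin2003Growth.rates_holds

/-- **Row G margin, UNCONDITIONAL**: any admissible decay exponent `c` and denominator exponent `δ` satisfy
`c - δ < -4.366`. -/
theorem margin_lt_holds {c δ : ℝ}
    (hc : ∀ᶠ n : ℕ in atTop, |form n| ≤ Real.exp (-(c * n)))
    (hδ : ∀ᶠ n : ℕ in atTop, (2 : ℝ) ^ (4 * n) * (Nat.lcmUpto (2 * n - 1) : ℝ) ^ 2 ≤ Real.exp (δ * n)) :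
    c - δ < -(4366 / 1000) :=
  margin_lt Zudilin2003Growth.rates_holds hc hδ

end CatalanFamily

/-! ### Corollaries (appended 2026-08-20, typer g5): the series never vanishes, effective approximation bound,
no certificate — all unconditional -/

namespace Zudilin2003Growth

/-- **`F_n = Σ_t (-1)^t R_n(t) ≠ 0` for every `n`** (the source takes this from Theorem 3; here from
`F_n = 8(uₙG - vₙ)` and `form_ne_zero`). -/
theorem F_ne_zero (n : ℕ) : F n ≠ 0 := by
  rw [F_eq_form]
  exact mul_ne_zero (by norm_num) (form_ne_zero n)

/-- **Effective approximation bound, UNCONDITIONAL** (was `abs_sub_catalan_le_of_theorem1`):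
`|G - v_{2+m}/u_{2+m}| ≤ (13/8)/((649/64)²·(15/2)) · (4/225)^m / (1 - 4/225)`. -/
theorem abs_sub_catalan_le (m : ℕ) :
    |catalanConstant - vR (2 + m) / uR (2 + m)| ≤
      13 / 8 / ((649 / 64) ^ 2 * (15 / 2)) * (4 / 225) ^ m / (1 - 4 / 225) :=
  abs_sub_catalan_le_of_theorem1 theorem1_holds m

end Zudilin2003Growth

/-- **No certificate from Zudilin's Catalan family, UNCONDITIONAL** (was `no_certificate_catalan (h : rates)`):
no `LinearFormCertificate catalanConstant` has `form n = uₙG - vₙ`, `denom n = 2^{4n}·lcm(1..2n-1)²` and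
bounded savings. -/
theorem no_certificate_catalan_holds (K : ℕ) :
    ¬ ∃ cert : LinearFormCertificate catalanConstant,
        (∀ n, cert.form n = form n)
        ∧ (∀ n, cert.denom n = 2 ^ (4 * n) * Nat.lcmUpto (2 * n - 1) ^ 2) ∧ (∀ n, cert.saving n ≤ K) :=
  no_certificate_catalan Zudilin2003Growth.rates_holds K

end Summit.KontsevichZagierPeriods.Zeta5Search
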